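import Literature.MathematicalPhysics.QuantumFieldTheory.Balaban1983to89.B9Eq369CurvFormConjugation
import Literature.MathematicalPhysics.QuantumFieldTheory.Balaban1983to89.B9Ineq369CurvatureTwoBackgroundsPlaquette
import Literature.MathematicalPhysics.QuantumFieldTheory.Balaban1983to89.B9Eq3101ConjugationLettersTwoBackgrounds

/-!
# `Balaban1983to89.B9Eq369CurvFormConjugationTwoBackgrounds` — T. Bałaban, *Propagators for lattice gauge theories in a background field*, Commun.
# Math. Phys. **99** (1985) 389–434 [Balaban1985BackgroundPropagators] (3.10) p. 392, (3.35) p. 396, (3.49) p. 399, (3.69) p. 404, (3.101)–(3.103) p. 414: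
# **THE CONJUGATED CURVATURE PART `Δ′` BETWEEN TWO BACKGROUNDS, TWO CLOSENESS LETTERS —
# `‖e^{κχ}(Δ′(V) − Δ′(U))e^{−κχ}‖ ≤ e^{2‖κ‖θ}·16d·C_τ·M_φ²·(|η|^d∕c₀)·|η|⁻²·(12δ_bε + 3δ_p)`** on the `L²` bond space, for unit-bounded backgrounds `U`, `V`
# at bond closeness `δ_b` AND plaquette closeness `δ_p`, plaquettes of `U` within `ε` of `1`, a gauge `χ` with bond increments `≤ θ`, and NO window on `κ`
# (on print's diagonal `δ_b = δη`, `ε = αη²`, `δ_p = δη²`, `c₀ = η^d`: `e^{2‖κ‖θ}·16d·C_τM_φ²(12αη + 3)·δ`, `η`-FREE) — with the ONE-letter reading (bond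
# closeness `δ` alone, `δ_p := 4δ`, `ε ≤ 1`: constant `384d·…·|η|⁻²δ`) as a corollary; the two-background twin of the NE9 owner's one-background Combes–Thomas
# letter `B9Eq369CurvFormConjugation.norm_conj_curvOp_sub_le` (`‖SΔ′S⁻¹ − Δ′‖ ≤ 8‖κ‖θ·p_K`), and at `κ = 0` this lineage's unconjugated two-background letters
# `B9Ineq369CurvatureTwoBackgroundsPlaquette.norm_curvOp_sub_le_of_plaq` ∕ `B9Ineq369CurvatureTwoBackgrounds.norm_curvOp_sub_le` verbatim

statement-level skeleton of published theorems with citation tags; proofs where landed; nothing here is a claim about the Yang–Mills mass gap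

PDF held: `paper:balaban1985-cmp99-background-propagators` (journal page = PDF page + 388); pp. 392, 396, 399, 404, 414 through the verbatim quotations of
the imported files (p. 392 *«the operator Δ′ will be a bounded, small operator»*; (3.35) p. 396 the `η`-scaled small-field class; (3.69) p. 404 *«Δ′(U′U) is a
small, bounded operator»*; (3.101)–(3.103) p. 414: print's own exponential-weight conjugation inside the random-walk expansion).  Print never conjugates `Δ′`
as an operator and never compares it at two backgrounds under the conjugation; both are letters of the cell's Combes–Thomas ROUTE (`t4/ROUTES-NE9.md` §L1.2
R2′, §L1.4 N52), not of print.

CITATION HEADER (lean-in-tree rule 2026-08-18).  Audit cell `pub-balaban`, sub-cell `t4`, NE9 crux team (2): LEAF PROVER 04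
(`b2b-balaban-t4-ne9-formalise-leaf-04` gen 81) — the `δ_K` socket of ne9-leaf-01 gen 88's lattice junction `B9Eq326ConjugatedDeltaATowerTwoBackgrounds.
norm_conjG1k_sub_conjG1k_le` (hypothesis `tK : ∀ f, ‖(S∘Δ′(V)∘S⁻¹)f − (S∘Δ′(U)∘S⁻¹)f‖ ≤ δ_K‖f‖`, displayed there and in its circle read-out; t4-ne9-idea-1
gen 151's N52 road (α) «the two-background difference of the bond propagator WITH decay»), DISCHARGED down to the closeness letters.  Imports the NE9
owner's (t4-ne9-p1 gen 93) `B9Eq369CurvFormConjugation` — re-used BY NAME: the base-point scalars `exp_eq_exp_base_mul` ∕ `exp_mul_exp_neg` ∕ `abs_sub_base_le`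
and the `L²` plumbing `inner_mulOp_eq` ∕ `star_toAlg_conjMul` ∕ `toAlg_mulOp` ∕ `norm_le_of_inner_le` (its `bilin_conj_sub_eq` is the pattern of §1's
`bilin_conj_eq_base`) — and this lineage's gen 77 `B9Ineq369CurvatureTwoBackgroundsPlaquette` — re-used BY NAME: the per-plaquette two-background blocks with
TWO letters `norm_curvBlock₁_sub_le_of_plaq` ∕ `norm_curvBlock₂_sub_le_of_plaq` (through it gen 73's `norm_plaqHolU_sub_le` for the one-letter corollaries;
the Cauchy–Schwarz step over plaquettes is gen 73 §2's text on `B9Ineq369CurvatureOperatorBound.sum_edgeSum_sq_le`) — and ne9-leaf-01 gen 88's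
`B9Eq3101ConjugationLettersTwoBackgrounds` for the scalar `norm_exp_mul_le_of_abs_le` (`‖e^{κΔ}‖ ≤ e^{‖κ‖θ}`, BY NAME).  Nothing of those files is modified.

THE MECHANISM.  At a plaquette `p` based at `x`, the conjugation weights factor through the base point: `e^{κχ(b₋)} = e^{κχ(x)}·w_p(b)`,
`e^{−κχ(b₋)} = e^{−κχ(x)}·w′_p(b)`, `w_p(b) = e^{κ(χ(b₋) − χ(x))}`, `w′_p(b) = e^{−κ(χ(b₋) − χ(x))}`, and for ANY bilinear plaquette functional `Φ` the two
base-point scalars cancel: `Φ(e^{κχ}A, e^{−κχ}B) = Φ(w_p•A, w′_p•B)` (§1 `bilin_conj_eq_base`).  With `Φ :=` the DIFFERENCE of the (3.10) plaquette blocks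
at `V` and at `U`, the two-background block bounds apply to the weighted fields, whose boundary sizes are `≤ e^{‖κ‖θ}` times the unweighted ones
(`|χ(b₋) − χ(x)| ≤ θ` on `∂p`, `‖e^{±κΔ}‖ ≤ e^{‖κ‖θ}` — no window).  Unlike the one-background letter (factor `8‖κ‖θ`, vanishing at `κ = 0`), the
two-background letter does not vanish at `κ = 0`: it is the unconjugated Lipschitz letter times `e^{2‖κ‖θ}`.

WHAT IS PROVED (sorry-free; proof lane — no `def`; [folklore] lattice bookkeeping + Hilbert-space plumbing, composition BY NAME).
* §1 scalars and weights: `norm_exp_neg_mul_ofReal_le` (`‖e^{−κΔ}‖ ≤ e^{‖κ‖θ}` for `|Δ| ≤ θ`; the `+` sign is ne9-leaf-01's, imported), **`bilin_conj_eq_base`**,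
  `abs_sub_base_edgeBond_le` (the four bonds of `∂p` are based within `θ` of `x`), `edgeSum_smul_le` (`E_{c•X}(p) ≤ ω·E_X(p)`).
* §2 one plaquette: **`norm_plaquette_conj_sub_conj_le_of_plaq`** (two letters: `≤ e^{2‖κ‖θ}·C_τ(12δ_bε + 3δ_p)|η|^d‖η⁻¹‖²·E_A(p)E_B(p)`).
* §3 the form: **`norm_curvForm_conj_sub_conj_le_of_plaq`** (sum over plaquettes).
* §4 on the `L²` bond space (bond multipliers `S = e^{κχ(b₋)}`, `S⁻¹ = e^{−κχ(b₋)}`, VERBATIM the `hS` ∕ `hSinv` of `B9Eq369CurvFormConjugation` and of the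
  junction): **`norm_inner_conj_curvOp_sub_conj_curvOp_le_of_plaq`** and THE LETTER **`norm_conj_curvOp_sub_conj_curvOp_le_of_plaq`**:
  `‖(S∘Δ′(V)∘S⁻¹)f − (S∘Δ′(U)∘S⁻¹)f‖ ≤ δ_K‖f‖`, **`δ_K = e^{2‖κ‖θ}·16d·C_τ·M_φ²·(|η|^d∕c₀)·|η|⁻²(12δ_bε + 3δ_p)`**; the one-letter corollaries
  `norm_inner_conj_curvOp_sub_conj_curvOp_le` ∕ **`norm_conj_curvOp_sub_conj_curvOp_le`** (`δ_K = e^{2‖κ‖θ}·384d·C_τ·M_φ²·(|η|^d∕c₀)·(|η|⁻²δ)`, bond closeness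
  only, `ε ≤ 1`) — either inhabits the `tK` hypothesis of `B9Eq326ConjugatedDeltaATowerTwoBackgrounds.norm_conjG1k_sub_conjG1k_le` (`θ := ℓη`) by `exact`.
MODEL ∕ DECLARED READINGS.  (M1) as `B9Ineq369CurvatureTwoBackgroundsPlaquette`: periodic lattice `Pd`, fibre `W` read in `𝔸` along `φ` (`‖φw‖ ≤ M_φ‖w‖`),
`τ` bounded by `C_τ` (`‖τX‖ ≤ C_τ‖X‖`), `‖X*‖ ≤ ‖X‖` (the owner's `hstar`), weight `c₀`; BOTH backgrounds unit-bounded with unit-bounded inverses; THREE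
displayed closeness ∕ window letters `δ_b`, `δ_p`, `ε` (the reading `δ_b = δη`, `ε = αη²`, `δ_p = δη²` is the consumer's line).  (M2) crude constants
(`16·(12δ_bε + 3δ_p)`, `384`, `e^{2‖κ‖θ}`; inside a window `‖κ‖θ ≤ 1` the factor is `≤ e²`).  (M3) ZEROTH order in `κ`, FIRST order in `V − U`.
HONEST SCOPE.  Elementary; ONE displayed letter (`δ_K`) of the N52 road (α) junction and of its circle read-out, NOT that junction (whose `δ_R`, `δ_Q` sockets
have no supplier yet), NOT NE9; nothing of [B9] Thm 3.1 ∕ 3.3 ∕ 3.4 ∕ 3.11 asserted; NOT summit progress (cell pub-balaban: «NE9 ⇐ the named binders»; NE9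
NOT PRINTED ∕ NOT PROVED; row WALLED ON A MODEL (O-NE9-1; #5 UNRULED); spine PROVED 0∕9; rung (B)+1 on a finite T⁴ — NOT infinite volume, NOT mass gap, NOT
BetaPertH, NOT Clay).  HONEST DEPENDENCY (cell line): continuum YM on T⁴ ⇐ BetaPertH ∧ nine spine estimates (0/9 proved); BetaPertH ⇐ (D1) ∧ (D4) ∧
CAP+tail; G-an2-4 gates asym, D1 and NE2/3/4.  NEW file; nothing modified.  Net new unproved facts: 0.
-/

noncomputable section

open scoped InnerProductSpace ComplexConjugate BigOperators
open Finset

namespace Literature.MathematicalPhysics.QuantumFieldTheory.Balaban1983to89.B9Eq369CurvFormConjugationTwoBackgrounds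

open B4Sect5Torus (TSite)
open B9SectCLatticeCarrier (Bond DirPair bpos btgt shift)
open B9Eq311L2Pairing (WL2)
open B11Eq103H1Complex (BondL2K)
open B9Eq310DeltaPrime (plaqHolU curvBlock₁ curvBlock₂ curvForm curvForm_apply)
open B9Eq310HessianOperator (curvOp inner_curvOp toAlg)
open B9Ineq369CurvatureSmall (edgeBond edgeSum edgeSum_nonneg)
open B9Ineq369CurvatureOperatorBound (sum_edgeSum_sq_le)
open B9Ineq369CurvatureTwoBackgrounds (norm_plaqHolU_sub_le)
open B9Ineq369CurvatureTwoBackgroundsPlaquette (norm_curvBlock₁_sub_le_of_plaq norm_curvBlock₂_sub_le_of_plaq)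
open B9Eq369CurvFormConjugation (exp_eq_exp_base_mul exp_mul_exp_neg abs_sub_base_le inner_mulOp_eq star_toAlg_conjMul toAlg_mulOp
  norm_le_of_inner_le)
open B9Eq3101ConjugationLettersTwoBackgrounds (norm_exp_mul_le_of_abs_le)

/-! ## §1 Scalars, the base-point identity, weighted boundary sizes -/

section Scalar

/-- **`‖e^{−κΔ}‖ ≤ e^{‖κ‖θ}`** for `|Δ| ≤ θ` — no window on `κ`; the negative-sign companion of ne9-leaf-01's
`B9Eq3101ConjugationLettersTwoBackgrounds.norm_exp_mul_le_of_abs_le` (re-used BY NAME for the positive sign). [folklore]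
[cite: Balaban1985BackgroundPropagators, (3.49) p.399, (3.101) p.414] -/
theorem norm_exp_neg_mul_ofReal_le {θ Δ : ℝ} (κ : ℂ) (hΔ : |Δ| ≤ θ) : ‖Complex.exp (-(κ * (Δ : ℂ)))‖ ≤ Real.exp (‖κ‖ * θ) := by
  have h := norm_exp_mul_le_of_abs_le (-κ) hΔ
  rwa [norm_neg, neg_mul] at h

/-- **THE BASE-POINT IDENTITY.**  For ANY bilinear `Φ`, scalars `s·r = 1` and weights `σ = s·w`, `ρ = r·w′`: `Φ(σ•A, ρ•B) = Φ(w•A, w′•B)` — the two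
base-point scalars cancel (the first step of the owner's `B9Eq369CurvFormConjugation.bilin_conj_sub_eq`). [folklore]
[cite: Balaban1985BackgroundPropagators, (3.101) p.414] -/
theorem bilin_conj_eq_base {ι M : Type*} [AddCommGroup M] [Module ℂ M] (Φ : (ι → M) →ₗ[ℂ] (ι → M) →ₗ[ℂ] ℂ) (σ ρ w w' : ι → ℂ) (s r : ℂ)
    (hsr : s * r = 1) (hσ : ∀ i, σ i = s * w i) (hρ : ∀ i, ρ i = r * w' i) (A B : ι → M) :
    Φ (fun i => σ i • A i) (fun i => ρ i • B i) = Φ (fun i => w i • A i) (fun i => w' i • B i) := by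
  have hA : (fun i => σ i • A i) = s • fun i => w i • A i := by funext i; rw [Pi.smul_apply, smul_smul, hσ]
  have hB : (fun i => ρ i • B i) = r • fun i => w' i • B i := by funext i; rw [Pi.smul_apply, smul_smul, hρ]
  rw [hA, hB, LinearMap.map_smul, LinearMap.map_smul, LinearMap.smul_apply, smul_eq_mul, smul_eq_mul]
  linear_combination (Φ (fun i => w i • A i) (fun i => w' i • B i)) * hsr

variable {d : ℕ} {Pd : Fin d → ℕ} {𝔸 : Type*} [NormedRing 𝔸] [NormedAlgebra ℂ 𝔸]
  {χ : TSite d Pd → ℝ} {θ : ℝ} (hθ : 0 ≤ θ) (hχ : ∀ b : Bond d Pd, |χ (bpos b) - χ (btgt b)| ≤ θ)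

include hθ hχ in
/-- The four bonds of `∂p` (in the order of `B9Ineq369CurvatureSmall.edgeBond`) are based within `θ` of the base point of `p` in the gauge `χ`
(the owner's `abs_sub_base_le`, re-indexed). [folklore] [cite: Balaban1985BackgroundPropagators, (3.2) p.390] -/
theorem abs_sub_base_edgeBond_le (p : B9SectCLatticeCarrier.Plaq d Pd) (k : Fin 4) : |χ (bpos (edgeBond p k)) - χ p.1| ≤ θ := by
  obtain ⟨x, q⟩ := p
  obtain ⟨d1, d2, d3, d4⟩ := abs_sub_base_le (d := d) (Pd := Pd) (χ := χ) hθ hχ x q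
  fin_cases k
  · exact d4
  · exact d2
  · exact d1
  · exact d3

/-- **Weighted boundary size**: `‖c(b)‖ ≤ ω` on the four bonds of `∂p` gives `E_{c•X}(p) ≤ ω·E_X(p)`. [folklore] [cite: Balaban1985BackgroundPropagators, (3.2) p.390] -/
theorem edgeSum_smul_le (c : Bond d Pd → ℂ) (X : Bond d Pd → 𝔸) (p : B9SectCLatticeCarrier.Plaq d Pd) {ω : ℝ}
    (h : ∀ k : Fin 4, ‖c (edgeBond p k)‖ ≤ ω) : edgeSum p (fun e => c e • X e) ≤ ω * edgeSum p X := by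
  rw [edgeSum, edgeSum, Finset.mul_sum]
  exact Finset.sum_le_sum fun k _ => by rw [norm_smul]; exact mul_le_mul_of_nonneg_right (h k) (norm_nonneg _)

end Scalar

/-! ## §2 One plaquette: the conjugated difference of the (3.10) blocks at `V` and at `U` -/

section Plaquette

variable {d : ℕ} {Pd : Fin d → ℕ} {𝔸 : Type*} [NormedRing 𝔸] [NormedAlgebra ℂ 𝔸] (τ : 𝔸 →ₗ[ℂ] ℂ) {Cτ : ℝ}
  (hτ : ∀ X, ‖τ X‖ ≤ Cτ * ‖X‖) (hCτ : 0 ≤ Cτ) (η : ℝ)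
  {U V : Bond d Pd → 𝔸ˣ} (hU : ∀ b, ‖(U b : 𝔸)‖ ≤ 1 ∧ ‖(((U b)⁻¹ : 𝔸ˣ) : 𝔸)‖ ≤ 1)
  (hV : ∀ b, ‖(V b : 𝔸)‖ ≤ 1 ∧ ‖(((V b)⁻¹ : 𝔸ˣ) : 𝔸)‖ ≤ 1)
  {κ : ℂ} {χ : TSite d Pd → ℝ} {θ : ℝ} (hθ : 0 ≤ θ) (hχ : ∀ b : Bond d Pd, |χ (bpos b) - χ (btgt b)| ≤ θ)

include hτ hCτ hU hV hθ hχ in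
/-- **ONE PLAQUETTE of `⟨e^{κχ}A, (Δ′(V) − Δ′(U)) e^{−κχ}B⟩`, TWO CLOSENESS LETTERS**: for bond closeness `‖U(b) − V(b)‖ ≤ δ_b`, plaquette closeness
`‖U(∂p) − V(∂p)‖ ≤ δ_p` and the plaquette holonomy of `U` at `p` within `ε` of `1`,
`‖η^d·[(blocks of V) − (blocks of U)](e^{κχ}A, e^{−κχ}B)‖ ≤ e^{2‖κ‖θ}·C_τ(12δ_bε + 3δ_p)|η|^d|η|⁻²·E_A(p)E_B(p)` — base-point weights pulled through the bilinear
difference (`bilin_conj_eq_base`), then this lineage's `norm_curvBlock₁_sub_le_of_plaq` ∕ `norm_curvBlock₂_sub_le_of_plaq` on the weighted fields, whose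
boundary sizes are `≤ e^{‖κ‖θ}` times the unweighted ones.  On print's diagonal (`δ_b = δη`, `ε = αη²`, `δ_p = δη²`) the letter is `η`-FREE.
[cite: Balaban1985BackgroundPropagators, (3.10) p.392, (3.35) p.396, (3.49) p.399, (3.69) p.404, (3.101) p.414] -/
theorem norm_plaquette_conj_sub_conj_le_of_plaq {δb δp ε : ℝ} (hδb : 0 ≤ δb) (hδp : 0 ≤ δp)
    (hUV : ∀ b, ‖(U b : 𝔸) - (V b : 𝔸)‖ ≤ δb) (hpp : ∀ p : B9SectCLatticeCarrier.Plaq d Pd, ‖(plaqHolU U p : 𝔸) - (plaqHolU V p : 𝔸)‖ ≤ δp)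
    {p : B9SectCLatticeCarrier.Plaq d Pd} (hp : ‖(plaqHolU U p : 𝔸) - 1‖ ≤ ε) (A B : Bond d Pd → 𝔸) :
    ‖((η : ℂ)) ^ d *
          (curvBlock₁ τ η V p (fun e => Complex.exp (κ * (χ (bpos e) : ℂ)) • A e) (fun e => Complex.exp (-(κ * (χ (bpos e) : ℂ))) • B e) +
            curvBlock₂ τ η V p (fun e => Complex.exp (κ * (χ (bpos e) : ℂ)) • A e) (fun e => Complex.exp (-(κ * (χ (bpos e) : ℂ))) • B e)) -
        ((η : ℂ)) ^ d *
          (curvBlock₁ τ η U p (fun e => Complex.exp (κ * (χ (bpos e) : ℂ)) • A e) (fun e => Complex.exp (-(κ * (χ (bpos e) : ℂ))) • B e) +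
            curvBlock₂ τ η U p (fun e => Complex.exp (κ * (χ (bpos e) : ℂ)) • A e) (fun e => Complex.exp (-(κ * (χ (bpos e) : ℂ))) • B e))‖ ≤
      Real.exp (2 * (‖κ‖ * θ)) * (Cτ * (12 * δb * ε + 3 * δp) * |η| ^ d * ‖((η : ℂ))⁻¹‖ ^ 2) * (edgeSum p A * edgeSum p B) := by
  have hε : 0 ≤ ε := (norm_nonneg _).trans hp
  -- the bilinear difference functional and the base-point factorisation
  set Φ : (Bond d Pd → 𝔸) →ₗ[ℂ] (Bond d Pd → 𝔸) →ₗ[ℂ] ℂ :=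
    ((η : ℂ)) ^ d • ((curvBlock₁ τ η V p + curvBlock₂ τ η V p) - (curvBlock₁ τ η U p + curvBlock₂ τ η U p)) with hΦdef
  have hΦ : ∀ X Y : Bond d Pd → 𝔸, Φ X Y = ((η : ℂ)) ^ d * (curvBlock₁ τ η V p X Y + curvBlock₂ τ η V p X Y) -
      ((η : ℂ)) ^ d * (curvBlock₁ τ η U p X Y + curvBlock₂ τ η U p X Y) := fun X Y => by
    simp only [hΦdef, LinearMap.smul_apply, LinearMap.sub_apply, LinearMap.add_apply, smul_eq_mul, mul_sub]
  set w : Bond d Pd → ℂ := fun e => Complex.exp (κ * ((χ (bpos e) - χ p.1 : ℝ) : ℂ)) with hw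
  set w' : Bond d Pd → ℂ := fun e => Complex.exp (-(κ * ((χ (bpos e) - χ p.1 : ℝ) : ℂ))) with hw'
  have key := bilin_conj_eq_base Φ (fun e => Complex.exp (κ * (χ (bpos e) : ℂ))) (fun e => Complex.exp (-(κ * (χ (bpos e) : ℂ)))) w w'
    (Complex.exp (κ * (χ p.1 : ℂ))) (Complex.exp (-(κ * (χ p.1 : ℂ)))) (exp_mul_exp_neg κ (χ p.1))
    (fun e => exp_eq_exp_base_mul κ (χ (bpos e)) (χ p.1))
    (fun e => by simpa only [neg_mul] using exp_eq_exp_base_mul (-κ) (χ (bpos e)) (χ p.1)) A B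
  rw [← hΦ, key, hΦ]
  -- the weighted fields and their boundary sizes
  have hwk : ∀ k : Fin 4, ‖w (edgeBond p k)‖ ≤ Real.exp (‖κ‖ * θ) := fun k =>
    norm_exp_mul_le_of_abs_le κ (abs_sub_base_edgeBond_le hθ hχ p k)
  have hwk' : ∀ k : Fin 4, ‖w' (edgeBond p k)‖ ≤ Real.exp (‖κ‖ * θ) := fun k =>
    norm_exp_neg_mul_ofReal_le κ (abs_sub_base_edgeBond_le hθ hχ p k)
  have hEA := edgeSum_smul_le w A p hwk
  have hEB := edgeSum_smul_le w' B p hwk'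
  have hEA0 : 0 ≤ edgeSum p A := edgeSum_nonneg p A
  -- the two-background blocks on the weighted fields (orientation `U − V`, then `norm_neg`)
  have h1 := norm_curvBlock₁_sub_le_of_plaq hU hV hUV hpp hτ hCτ η hδb hp (fun e => w e • A e) (fun e => w' e • B e)
  have h2 := norm_curvBlock₂_sub_le_of_plaq hU hV hUV hpp hτ hCτ η hδb hδp hp (fun e => w e • A e) (fun e => w' e • B e)
  have hK : 0 ≤ Cτ * (12 * δb * ε + 3 * δp) * ‖((η : ℂ))⁻¹‖ ^ 2 := by positivity
  have hprod : edgeSum p (fun e => w e • A e) * edgeSum p (fun e => w' e • B e) ≤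
      Real.exp (2 * (‖κ‖ * θ)) * (edgeSum p A * edgeSum p B) := by
    calc _ ≤ (Real.exp (‖κ‖ * θ) * edgeSum p A) * (Real.exp (‖κ‖ * θ) * edgeSum p B) :=
          mul_le_mul hEA hEB (edgeSum_nonneg p _) (mul_nonneg (Real.exp_nonneg _) hEA0)
      _ = Real.exp (2 * (‖κ‖ * θ)) * (edgeSum p A * edgeSum p B) := by rw [two_mul, Real.exp_add]; ring
  have hblocks : ‖(curvBlock₁ τ η V p (fun e => w e • A e) (fun e => w' e • B e) + curvBlock₂ τ η V p (fun e => w e • A e) (fun e => w' e • B e)) -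
      (curvBlock₁ τ η U p (fun e => w e • A e) (fun e => w' e • B e) + curvBlock₂ τ η U p (fun e => w e • A e) (fun e => w' e • B e))‖ ≤
      Cτ * (12 * δb * ε + 3 * δp) * ‖((η : ℂ))⁻¹‖ ^ 2 * (edgeSum p (fun e => w e • A e) * edgeSum p (fun e => w' e • B e)) := by
    rw [show curvBlock₁ τ η V p (fun e => w e • A e) (fun e => w' e • B e) + curvBlock₂ τ η V p (fun e => w e • A e) (fun e => w' e • B e) -
        (curvBlock₁ τ η U p (fun e => w e • A e) (fun e => w' e • B e) + curvBlock₂ τ η U p (fun e => w e • A e) (fun e => w' e • B e)) =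
      -((curvBlock₁ τ η U p (fun e => w e • A e) (fun e => w' e • B e) - curvBlock₁ τ η V p (fun e => w e • A e) (fun e => w' e • B e)) +
        (curvBlock₂ τ η U p (fun e => w e • A e) (fun e => w' e • B e) - curvBlock₂ τ η V p (fun e => w e • A e) (fun e => w' e • B e))) by abel,
      norm_neg]
    refine (norm_add_le _ _).trans ?_
    nlinarith [h1, h2]
  calc _ = ‖((η : ℂ)) ^ d‖ *
        ‖(curvBlock₁ τ η V p (fun e => w e • A e) (fun e => w' e • B e) + curvBlock₂ τ η V p (fun e => w e • A e) (fun e => w' e • B e)) -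
          (curvBlock₁ τ η U p (fun e => w e • A e) (fun e => w' e • B e) + curvBlock₂ τ η U p (fun e => w e • A e) (fun e => w' e • B e))‖ := by
        rw [← mul_sub, norm_mul]
    _ ≤ |η| ^ d * (Cτ * (12 * δb * ε + 3 * δp) * ‖((η : ℂ))⁻¹‖ ^ 2 * (Real.exp (2 * (‖κ‖ * θ)) * (edgeSum p A * edgeSum p B))) := by
        rw [norm_pow, Complex.norm_real, Real.norm_eq_abs]
        exact mul_le_mul_of_nonneg_left (hblocks.trans (mul_le_mul_of_nonneg_left hprod hK)) (by positivity)
    _ = _ := by ring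

end Plaquette

/-! ## §3 The sum over plaquettes: the conjugated difference of the two curvature forms -/

section Sum

variable {d : ℕ} {Pd : Fin d → ℕ} {𝔸 : Type*} [NormedRing 𝔸] [NormedAlgebra ℂ 𝔸] (τ : 𝔸 →ₗ[ℂ] ℂ) {Cτ : ℝ}
  (hτ : ∀ X, ‖τ X‖ ≤ Cτ * ‖X‖) (hCτ : 0 ≤ Cτ) (η : ℝ)
  {U V : Bond d Pd → 𝔸ˣ} (hU : ∀ b, ‖(U b : 𝔸)‖ ≤ 1 ∧ ‖(((U b)⁻¹ : 𝔸ˣ) : 𝔸)‖ ≤ 1)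
  (hV : ∀ b, ‖(V b : 𝔸)‖ ≤ 1 ∧ ‖(((V b)⁻¹ : 𝔸ˣ) : 𝔸)‖ ≤ 1)
  {ε : ℝ} (hpl : ∀ p : B9SectCLatticeCarrier.Plaq d Pd, ‖(plaqHolU U p : 𝔸) - 1‖ ≤ ε)
  {κ : ℂ} {χ : TSite d Pd → ℝ} {θ : ℝ} (hθ : 0 ≤ θ) (hχ : ∀ b : Bond d Pd, |χ (bpos b) - χ (btgt b)| ≤ θ)

include hτ hCτ hU hV hpl hθ hχ in
/-- **THE CONJUGATED DIFFERENCE OF THE TWO CURVATURE FORMS, TWO CLOSENESS LETTERS**: `‖curvForm_V(e^{κχ}A, e^{−κχ}B) − curvForm_U(e^{κχ}A, e^{−κχ}B)‖ ≤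
e^{2‖κ‖θ}·C_τ(12δ_bε + 3δ_p)|η|^d|η|⁻²·Σ_p E_A(p)E_B(p)` (plaquette by plaquette, §2). [cite: Balaban1985BackgroundPropagators, (3.10) p.392, (3.35) p.396, (3.49) p.399, (3.69) p.404, (3.101) p.414] -/
theorem norm_curvForm_conj_sub_conj_le_of_plaq {δb δp : ℝ} (hδb : 0 ≤ δb) (hδp : 0 ≤ δp)
    (hUV : ∀ b, ‖(U b : 𝔸) - (V b : 𝔸)‖ ≤ δb) (hpp : ∀ p : B9SectCLatticeCarrier.Plaq d Pd, ‖(plaqHolU U p : 𝔸) - (plaqHolU V p : 𝔸)‖ ≤ δp)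
    (A B : Bond d Pd → 𝔸) :
    ‖curvForm τ η V (fun e => Complex.exp (κ * (χ (bpos e) : ℂ)) • A e) (fun e => Complex.exp (-(κ * (χ (bpos e) : ℂ))) • B e) -
        curvForm τ η U (fun e => Complex.exp (κ * (χ (bpos e) : ℂ)) • A e) (fun e => Complex.exp (-(κ * (χ (bpos e) : ℂ))) • B e)‖ ≤
      Real.exp (2 * (‖κ‖ * θ)) * (Cτ * (12 * δb * ε + 3 * δp) * |η| ^ d * ‖((η : ℂ))⁻¹‖ ^ 2) *
        ∑ p : B9SectCLatticeCarrier.Plaq d Pd, edgeSum p A * edgeSum p B := by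
  rw [curvForm_apply, curvForm_apply, ← Finset.sum_sub_distrib, Finset.mul_sum]
  exact (norm_sum_le _ _).trans (Finset.sum_le_sum fun p _ =>
    norm_plaquette_conj_sub_conj_le_of_plaq τ hτ hCτ η hU hV hθ hχ hδb hδp hUV hpp (hpl p) A B)

end Sum

/-! ## §4 On the `L²` bond space: the letter `δ_K` -/

section L2

variable {d : ℕ} {Pd : Fin d → ℕ} {𝔸 : Type*} [NormedRing 𝔸] [StarRing 𝔸] [NormedAlgebra ℂ 𝔸] [StarModule ℂ 𝔸]
  {W : Type*} [NormedAddCommGroup W] [InnerProductSpace ℂ W] [FiniteDimensional ℂ W] (φ : W ≃ₗ[ℂ] 𝔸) {Mφ : ℝ}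
  (hφ : ∀ w, ‖φ w‖ ≤ Mφ * ‖w‖) (hMφ : 0 ≤ Mφ) (hstar : ∀ X : 𝔸, ‖star X‖ ≤ ‖X‖)
  {c₀ : ℝ} [Fact (0 < c₀)] (τ : 𝔸 →ₗ[ℂ] ℂ) {Cτ : ℝ} (hτ : ∀ X, ‖τ X‖ ≤ Cτ * ‖X‖) (hCτ : 0 ≤ Cτ) (η : ℝ)
  {U V : Bond d Pd → 𝔸ˣ} (hU : ∀ b, ‖(U b : 𝔸)‖ ≤ 1 ∧ ‖(((U b)⁻¹ : 𝔸ˣ) : 𝔸)‖ ≤ 1)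
  (hV : ∀ b, ‖(V b : 𝔸)‖ ≤ 1 ∧ ‖(((V b)⁻¹ : 𝔸ˣ) : 𝔸)‖ ≤ 1)
  {ε : ℝ} (hpl : ∀ p : B9SectCLatticeCarrier.Plaq d Pd, ‖(plaqHolU U p : 𝔸) - 1‖ ≤ ε)
  {κ : ℂ} {χ : TSite d Pd → ℝ} {θ : ℝ} (hθ : 0 ≤ θ) (hχ : ∀ b : Bond d Pd, |χ (bpos b) - χ (btgt b)| ≤ θ)
  {S Sinv : BondL2K ℂ d Pd c₀ W →ₗ[ℂ] BondL2K ℂ d Pd c₀ W}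
  (hS : ∀ (g : BondL2K ℂ d Pd c₀ W) (b : Bond d Pd),
    WL2.equiv ℂ (fun _ : Bond d Pd => c₀) W (S g) b = Complex.exp (κ * (χ (bpos b) : ℂ)) • WL2.equiv ℂ (fun _ : Bond d Pd => c₀) W g b)
  (hSinv : ∀ (g : BondL2K ℂ d Pd c₀ W) (b : Bond d Pd),
    WL2.equiv ℂ (fun _ : Bond d Pd => c₀) W (Sinv g) b = Complex.exp (-(κ * (χ (bpos b) : ℂ))) • WL2.equiv ℂ (fun _ : Bond d Pd => c₀) W g b)

include hφ hMφ hstar hτ hCτ hU hV hpl hθ hχ hS hSinv in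
/-- **THE BILINEAR FORM OF `SΔ′(V)S⁻¹ − SΔ′(U)S⁻¹`, TWO CLOSENESS LETTERS**: for `‖U(b) − V(b)‖ ≤ δ_b`, `‖U(∂p) − V(∂p)‖ ≤ δ_p`, plaquettes of `U` within
`ε ≥ 0` of `1`: `‖⟪g, SΔ′(V)S⁻¹f − SΔ′(U)S⁻¹f⟫‖ ≤ e^{2‖κ‖θ}·16d·C_τ·M_φ²·(|η|^d∕c₀)·|η|⁻²(12δ_bε + 3δ_p)·‖g‖‖f‖` (`⟪g, S(·)⟫ = ⟪S̄g, ·⟫`,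
`(Φ(S̄g))* = e^{κχ}(Φg)*`, `Φ(S⁻¹f) = e^{−κχ}Φf` — the owner's `inner_mulOp_eq` ∕ `star_toAlg_conjMul` ∕ `toAlg_mulOp`; then §3 and Cauchy–Schwarz over the
plaquettes with the `4d` incidence count, as `B9Ineq369CurvatureTwoBackgroundsPlaquette.norm_inner_curvOp_sub_le_of_plaq`).
[cite: Balaban1985BackgroundPropagators, (3.10) p.392, (3.35) p.396, (3.49) p.399, (3.69) p.404, (3.101) p.414] -/
theorem norm_inner_conj_curvOp_sub_conj_curvOp_le_of_plaq {δb δp : ℝ} (hδb : 0 ≤ δb) (hδp : 0 ≤ δp) (hε : 0 ≤ ε)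
    (hUV : ∀ b, ‖(U b : 𝔸) - (V b : 𝔸)‖ ≤ δb) (hpp : ∀ p : B9SectCLatticeCarrier.Plaq d Pd, ‖(plaqHolU U p : 𝔸) - (plaqHolU V p : 𝔸)‖ ≤ δp)
    (g f : BondL2K ℂ d Pd c₀ W) :
    ‖⟪g, S (curvOp φ τ η V (Sinv f)) - S (curvOp φ τ η U (Sinv f))⟫_ℂ‖ ≤
      Real.exp (2 * (‖κ‖ * θ)) * (16 * d * Cτ * Mφ ^ 2 * (|η| ^ d / c₀) * (‖((η : ℂ))⁻¹‖ ^ 2 * (12 * δb * ε + 3 * δp))) * (‖g‖ * ‖f‖) := by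
  have hc₀ : 0 < c₀ := Fact.out
  set Sc : BondL2K ℂ d Pd c₀ W → BondL2K ℂ d Pd c₀ W := fun g =>
    (WL2.equiv ℂ (fun _ : Bond d Pd => c₀) W).symm fun b =>
      (starRingEnd ℂ) (Complex.exp (κ * (χ (bpos b) : ℂ))) • WL2.equiv ℂ (fun _ : Bond d Pd => c₀) W g b with hScdef
  have hSc : ∀ (g : BondL2K ℂ d Pd c₀ W) (b : Bond d Pd), WL2.equiv ℂ (fun _ : Bond d Pd => c₀) W (Sc g) b =
      (starRingEnd ℂ) (Complex.exp (κ * (χ (bpos b) : ℂ))) • WL2.equiv ℂ (fun _ : Bond d Pd => c₀) W g b := fun g b => rfl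
  rw [inner_sub_right, inner_mulOp_eq (fun b => Complex.exp (κ * (χ (bpos b) : ℂ))) (S := S) (Sc := Sc) hS hSc,
    inner_mulOp_eq (fun b => Complex.exp (κ * (χ (bpos b) : ℂ))) (S := S) (Sc := Sc) hS hSc, inner_curvOp, inner_curvOp,
    star_toAlg_conjMul φ (fun b => Complex.exp (κ * (χ (bpos b) : ℂ))) hSc g,
    toAlg_mulOp φ (fun b => Complex.exp (-(κ * (χ (bpos b) : ℂ)))) hSinv f]
  have h1 := norm_curvForm_conj_sub_conj_le_of_plaq τ hτ hCτ η hU hV hpl hθ hχ (κ := κ) hδb hδp hUV hpp (star (toAlg φ g)) (toAlg φ f)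
  -- Cauchy–Schwarz over the plaquettes (the text of `B9Ineq369CurvatureTwoBackgrounds.norm_inner_curvOp_sub_le`)
  have hCS : ∑ p : B9SectCLatticeCarrier.Plaq d Pd, edgeSum p (star (toAlg φ g)) * edgeSum p (toAlg φ f) ≤
      Real.sqrt (∑ p : B9SectCLatticeCarrier.Plaq d Pd, edgeSum p (star (toAlg φ g)) ^ 2) *
        Real.sqrt (∑ p : B9SectCLatticeCarrier.Plaq d Pd, edgeSum p (toAlg φ f) ^ 2) := by
    have h := Real.sum_mul_le_sqrt_mul_sqrt (univ : Finset (B9SectCLatticeCarrier.Plaq d Pd)) (fun p => edgeSum p (star (toAlg φ g)))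
      (fun p => edgeSum p (toAlg φ f))
    simpa using h
  have hg := sum_edgeSum_sq_le g (star (toAlg φ g)) (fun b => (hstar _).trans (hφ _))
  have hf := sum_edgeSum_sq_le f (toAlg φ f) (fun b => hφ _)
  have hsd : Real.sqrt d ^ 2 = d := Real.sq_sqrt (Nat.cast_nonneg d)
  have hsc : Real.sqrt c₀ ^ 2 = c₀ := Real.sq_sqrt hc₀.le
  have hroot : ∀ (z : BondL2K ℂ d Pd c₀ W) (X : Bond d Pd → 𝔸),
      ∑ p : B9SectCLatticeCarrier.Plaq d Pd, edgeSum p X ^ 2 ≤ 16 * d * Mφ ^ 2 * (‖z‖ ^ 2 / c₀) →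
      Real.sqrt (∑ p : B9SectCLatticeCarrier.Plaq d Pd, edgeSum p X ^ 2) ≤ 4 * Real.sqrt d * Mφ * ‖z‖ / Real.sqrt c₀ := fun z X hz => by
    have ha : 0 ≤ 4 * Real.sqrt d * Mφ * ‖z‖ / Real.sqrt c₀ := by positivity
    have hsq : (4 * Real.sqrt d * Mφ * ‖z‖ / Real.sqrt c₀) ^ 2 = 16 * d * Mφ ^ 2 * (‖z‖ ^ 2 / c₀) := by
      rw [div_pow, show (4 * Real.sqrt d * Mφ * ‖z‖) ^ 2 = 16 * Real.sqrt d ^ 2 * Mφ ^ 2 * ‖z‖ ^ 2 by ring, hsd, hsc]; ring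
    calc Real.sqrt (∑ p : B9SectCLatticeCarrier.Plaq d Pd, edgeSum p X ^ 2) ≤ Real.sqrt ((4 * Real.sqrt d * Mφ * ‖z‖ / Real.sqrt c₀) ^ 2) :=
          Real.sqrt_le_sqrt (by rw [hsq]; exact hz)
      _ = 4 * Real.sqrt d * Mφ * ‖z‖ / Real.sqrt c₀ := Real.sqrt_sq ha
  have hprod : ∑ p : B9SectCLatticeCarrier.Plaq d Pd, edgeSum p (star (toAlg φ g)) * edgeSum p (toAlg φ f) ≤
      (4 * Real.sqrt d * Mφ * ‖g‖ / Real.sqrt c₀) * (4 * Real.sqrt d * Mφ * ‖f‖ / Real.sqrt c₀) :=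
    hCS.trans (mul_le_mul (hroot g _ hg) (hroot f _ hf) (Real.sqrt_nonneg _) (by positivity))
  have hA : 0 ≤ Real.exp (2 * (‖κ‖ * θ)) * (Cτ * (12 * δb * ε + 3 * δp) * |η| ^ d * ‖((η : ℂ))⁻¹‖ ^ 2) := by positivity
  refine h1.trans ?_
  calc Real.exp (2 * (‖κ‖ * θ)) * (Cτ * (12 * δb * ε + 3 * δp) * |η| ^ d * ‖((η : ℂ))⁻¹‖ ^ 2) *
        ∑ p : B9SectCLatticeCarrier.Plaq d Pd, edgeSum p (star (toAlg φ g)) * edgeSum p (toAlg φ f)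
      ≤ Real.exp (2 * (‖κ‖ * θ)) * (Cτ * (12 * δb * ε + 3 * δp) * |η| ^ d * ‖((η : ℂ))⁻¹‖ ^ 2) *
        ((4 * Real.sqrt d * Mφ * ‖g‖ / Real.sqrt c₀) * (4 * Real.sqrt d * Mφ * ‖f‖ / Real.sqrt c₀)) :=
        mul_le_mul_of_nonneg_left hprod hA
    _ = Real.exp (2 * (‖κ‖ * θ)) * (16 * d * Cτ * Mφ ^ 2 * (|η| ^ d / c₀) * (‖((η : ℂ))⁻¹‖ ^ 2 * (12 * δb * ε + 3 * δp))) * (‖g‖ * ‖f‖) := by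
        rw [show (4 * Real.sqrt d * Mφ * ‖g‖ / Real.sqrt c₀) * (4 * Real.sqrt d * Mφ * ‖f‖ / Real.sqrt c₀) =
          16 * Real.sqrt d ^ 2 * Mφ ^ 2 * ‖g‖ * ‖f‖ / Real.sqrt c₀ ^ 2 by rw [div_mul_div_comm]; ring, hsd, hsc]
        rw [div_eq_mul_inv, div_eq_mul_inv]
        ring

include hφ hMφ hstar hτ hCτ hU hV hpl hθ hχ hS hSinv in
/-- **THE CONJUGATED TWO-BACKGROUND `Δ′` LETTER `δ_K`, TWO CLOSENESS LETTERS: `‖(S∘Δ′(V)∘S⁻¹)f − (S∘Δ′(U)∘S⁻¹)f‖ ≤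
e^{2‖κ‖θ}·16d·C_τ·M_φ²·(|η|^d∕c₀)·|η|⁻²(12δ_bε + 3δ_p)·‖f‖`** — the `tK` hypothesis of ne9-leaf-01's `B9Eq326ConjugatedDeltaATowerTwoBackgrounds.norm_conjG1k_sub_conjG1k_le`
(there with `θ = ℓη`), DISCHARGED to bond closeness `δ_b`, plaquette closeness `δ_p`, the plaquette window `ε ≥ 0` of `U`, unit-bounded `U^{±1}`, `V^{±1}`,
`|χ(b₋) − χ(b₊)| ≤ θ`; NO window on `κ`; on print's diagonal (`δ_b = δη`, `ε = αη²`, `δ_p = δη²`, `c₀ = η^d`) this is `e^{2‖κ‖θ}·16d·C_τM_φ²(12αη + 3)δ·‖f‖` —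
`η`-FREE; at `κ = 0` the constant is this lineage's `B9Ineq369CurvatureTwoBackgroundsPlaquette.norm_curvOp_sub_le_of_plaq`'s.
[cite: Balaban1985BackgroundPropagators, (3.10) p.392, (3.35) p.396, (3.49) p.399, (3.69) p.404, (3.101) p.414] -/
theorem norm_conj_curvOp_sub_conj_curvOp_le_of_plaq {δb δp : ℝ} (hδb : 0 ≤ δb) (hδp : 0 ≤ δp) (hε : 0 ≤ ε)
    (hUV : ∀ b, ‖(U b : 𝔸) - (V b : 𝔸)‖ ≤ δb) (hpp : ∀ p : B9SectCLatticeCarrier.Plaq d Pd, ‖(plaqHolU U p : 𝔸) - (plaqHolU V p : 𝔸)‖ ≤ δp)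
    (f : BondL2K ℂ d Pd c₀ W) :
    ‖(S ∘ₗ curvOp φ τ η V ∘ₗ Sinv) f - (S ∘ₗ curvOp φ τ η U ∘ₗ Sinv) f‖ ≤
      Real.exp (2 * (‖κ‖ * θ)) * (16 * d * Cτ * Mφ ^ 2 * (|η| ^ d / c₀) * (‖((η : ℂ))⁻¹‖ ^ 2 * (12 * δb * ε + 3 * δp))) * ‖f‖ := by
  have hc₀ : 0 < c₀ := Fact.out
  have h := norm_inner_conj_curvOp_sub_conj_curvOp_le_of_plaq φ hφ hMφ hstar τ hτ hCτ η hU hV hpl hθ hχ hS hSinv hδb hδp hε hUV hpp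
    ((S ∘ₗ curvOp φ τ η V ∘ₗ Sinv) f - (S ∘ₗ curvOp φ τ η U ∘ₗ Sinv) f) f
  simp only [LinearMap.comp_apply] at h ⊢
  exact norm_le_of_inner_le _ f (by positivity) h

include hφ hMφ hstar hτ hCτ hU hV hpl hθ hχ hS hSinv in
/-- **THE BILINEAR FORM, ONE CLOSENESS LETTER** (the gen-81 v1 statement, now a corollary at `δ_p := 4δ`, `ε ≤ 1`):
`‖⟪g, SΔ′(V)S⁻¹f − SΔ′(U)S⁻¹f⟫‖ ≤ e^{2‖κ‖θ}·384d·C_τ·M_φ²·(|η|^d∕c₀)·(|η|⁻²δ)·‖g‖‖f‖` for `‖U(b) − V(b)‖ ≤ δ`.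
[cite: Balaban1985BackgroundPropagators, (3.10) p.392, (3.49) p.399, (3.69) p.404, (3.101) p.414] -/
theorem norm_inner_conj_curvOp_sub_conj_curvOp_le {δ : ℝ} (hδ : 0 ≤ δ) (hUV : ∀ b, ‖(U b : 𝔸) - (V b : 𝔸)‖ ≤ δ) (hε1 : ε ≤ 1)
    (g f : BondL2K ℂ d Pd c₀ W) :
    ‖⟪g, S (curvOp φ τ η V (Sinv f)) - S (curvOp φ τ η U (Sinv f))⟫_ℂ‖ ≤
      Real.exp (2 * (‖κ‖ * θ)) * (384 * d * Cτ * Mφ ^ 2 * (|η| ^ d / c₀) * (‖((η : ℂ))⁻¹‖ ^ 2 * δ)) * (‖g‖ * ‖f‖) := by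
  have hc₀ : 0 < c₀ := Fact.out
  -- the plaquette window may be replaced by `max ε 0 ∈ [0, 1]`; plaquette closeness `4δ` from bond closeness
  have hpl' : ∀ p : B9SectCLatticeCarrier.Plaq d Pd, ‖(plaqHolU U p : 𝔸) - 1‖ ≤ max ε 0 := fun p => (hpl p).trans (le_max_left _ _)
  have hpp : ∀ p : B9SectCLatticeCarrier.Plaq d Pd, ‖(plaqHolU U p : 𝔸) - (plaqHolU V p : 𝔸)‖ ≤ 4 * δ := fun p => norm_plaqHolU_sub_le hU hV hUV p
  have h := norm_inner_conj_curvOp_sub_conj_curvOp_le_of_plaq φ hφ hMφ hstar τ hτ hCτ η hU hV hpl' hθ hχ hS hSinv hδ (by positivity) (le_max_right _ _)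
    hUV hpp g f
  refine h.trans (mul_le_mul_of_nonneg_right (mul_le_mul_of_nonneg_left ?_ (Real.exp_nonneg _)) (by positivity))
  have hm1 : max ε 0 ≤ 1 := max_le hε1 zero_le_one
  have hin : 12 * δ * max ε 0 + 3 * (4 * δ) ≤ 24 * δ := by nlinarith [mul_le_mul_of_nonneg_left hm1 hδ]
  have h0 : 0 ≤ 16 * d * Cτ * Mφ ^ 2 * (|η| ^ d / c₀) * ‖((η : ℂ))⁻¹‖ ^ 2 := by positivity
  nlinarith [mul_le_mul_of_nonneg_left hin h0]

include hφ hMφ hstar hτ hCτ hU hV hpl hθ hχ hS hSinv in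
/-- **THE CONJUGATED TWO-BACKGROUND `Δ′` LETTER `δ_K`, ONE CLOSENESS LETTER** (the gen-81 v1 statement, now a corollary):
`‖(S∘Δ′(V)∘S⁻¹)f − (S∘Δ′(U)∘S⁻¹)f‖ ≤ e^{2‖κ‖θ}·384d·C_τ·M_φ²·(|η|^d∕c₀)·(|η|⁻²δ)·‖f‖` for bond closeness `‖U(b) − V(b)‖ ≤ δ` and plaquettes of `U` within
`ε ≤ 1` of `1` — the `tK` socket of `…norm_conjG1k_sub_conjG1k_le` by `exact`; on the diagonal prefer `…_of_plaq` (this one reads `O(δ∕η)` at `δ := δη`); at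
`κ = 0` the constant is this lineage's `B9Ineq369CurvatureTwoBackgrounds.norm_curvOp_sub_le`'s. [cite: Balaban1985BackgroundPropagators, (3.10) p.392, (3.49) p.399, (3.69) p.404, (3.101) p.414] -/
theorem norm_conj_curvOp_sub_conj_curvOp_le {δ : ℝ} (hδ : 0 ≤ δ) (hUV : ∀ b, ‖(U b : 𝔸) - (V b : 𝔸)‖ ≤ δ) (hε1 : ε ≤ 1)
    (f : BondL2K ℂ d Pd c₀ W) :
    ‖(S ∘ₗ curvOp φ τ η V ∘ₗ Sinv) f - (S ∘ₗ curvOp φ τ η U ∘ₗ Sinv) f‖ ≤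
      Real.exp (2 * (‖κ‖ * θ)) * (384 * d * Cτ * Mφ ^ 2 * (|η| ^ d / c₀) * (‖((η : ℂ))⁻¹‖ ^ 2 * δ)) * ‖f‖ := by
  have hc₀ : 0 < c₀ := Fact.out
  have h := norm_inner_conj_curvOp_sub_conj_curvOp_le φ hφ hMφ hstar τ hτ hCτ η hU hV hpl hθ hχ hS hSinv hδ hUV hε1
    ((S ∘ₗ curvOp φ τ η V ∘ₗ Sinv) f - (S ∘ₗ curvOp φ τ η U ∘ₗ Sinv) f) f
  simp only [LinearMap.comp_apply] at h ⊢
  exact norm_le_of_inner_le _ f (by positivity) h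

end L2

end Literature.MathematicalPhysics.QuantumFieldTheory.Balaban1983to89.B9Eq369CurvFormConjugationTwoBackgrounds

end
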